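import Mathlib
import Summits.NavierStokesRegularity.NavierStokesRegularity.Theorems.TypeIQuarterGateScarEnvelopeTypeIZoomDictionaryDefs
import Summits.NavierStokesRegularity.NavierStokesRegularity.Theorems.TypeIQuarterGateScarEnvelopeTypeIFatKill
import Summits.NavierStokesRegularity.NavierStokesRegularity.Theorems.TypeIQuarterGateScarEnvelopeTypeIBudgetViolators
import Summits.NavierStokesRegularity.NavierStokesRegularity.Theorems.TypeIQuarterGateScarEnvelopeTypeIOfNoTwinScarObject
import Summits.NavierStokesRegularity.NavierStokesRegularity.Theorems.TypeIQuarterGateQuarterLawTypeIGlue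
import Summits.NavierStokesRegularity.NavierStokesRegularity.Theorems.TypeIQuarterGateEnvelopeQuarterLaw
import Summits.NavierStokesRegularity.NavierStokesRegularity.Theorems.TypeIQuarterGateScarEnvelopeTypeINearOneRateDss
import Literature.Analysis.FluidPDE.AncientAxisymmetricTypeILiouville
import Summits.NavierStokesRegularity.NavierStokesRegularity.Theorems.TypeIQuarterGateScarEnvelopeTypeIZoomDictionaryCrux
import Summits.NavierStokesRegularity.NavierStokesRegularity.Theorems.TypeIQuarterGateScarEnvelopeTypeISatelliteTowerDefs

/-!
# Part K9: T0 — the tower is ROOTED in the engine class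

Part K9 of the plate: `abTower_rooted` (the tree proof of `SliceBudget.exists_twinScarObject_inBall` re-run keeping the engine outputs `H` and `𝐈 < ⊤`) and `exists_abTower_of_not_scarEnvelopeTypeI`.

PROVENANCE: declaration texts VERBATIM from the HOME plates of the instrument seat nsreg-p3 (g24/g25, cell
`pub/ns-regularity-ideate`): `round-31/Tangent31prep.lean` v5 (sha16 `e5b8668e3a090216`; = ROUND-30 plate v10 + Part K) and,
for Part L, `round-32/Tangent32prep.lean` v6 (sha16 `6123f27718636121`);
the author cannot write under `Theorems/` (`perm.theorems-prover-only`); landed by the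
LEAD-lineage prover ns-sz-p1 g5 on director-ns DIRECTOR-NS #218 (2), split into ≤ 400-line modules (the
plate's `def`s gathered in `TypeIQuarterGateScarEnvelopeTypeIZoomDictionaryDefs`), namespace
`Summit.NavierStokesRegularity.NavierStokesRegularity.Cruxes.ScarEnvelopeTypeI.ZoomDictionary` (the plate's `NsregP3.R30P`), `E3` spelled out, one-line docstrings
added where the plate had none.  `--supports stmt-NavierStokesRegularity-23843 --as helper`.

HONEST FRAMING: dictionary / census TOOLING for the crux `TypeIQuarterGate.ScarEnvelopeTypeI` (item 23843):
equivalences and normal forms, kernel-checked; NO open statement is proved — 23843, its parent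
`QuarterLawTypeI` (23726), the route and Navier–Stokes regularity are OPEN; hard core evaded: none.
-/

-- the summit-side namespace repeats a component by design (single-conjunct summit, D-0017)
set_option linter.dupNamespace false

open MeasureTheory Set Metric Filter Topology
open scoped ENNReal

namespace Summit.NavierStokesRegularity.NavierStokesRegularity.Cruxes.ScarEnvelopeTypeI.ZoomDictionary

variable {u : ℝ → (EuclideanSpace ℝ (Fin 3)) → (EuclideanSpace ℝ (Fin 3))} {a : (EuclideanSpace ℝ (Fin 3))} {ν T : ℝ}

section Tower

open Literature.Analysis.FluidPDE
variable {U : ℝ → (EuclideanSpace ℝ (Fin 3)) → (EuclideanSpace ℝ (Fin 3))} {P : ℝ → (EuclideanSpace ℝ (Fin 3)) → ℝ} {y' : (EuclideanSpace ℝ (Fin 3))} {ν : ℝ}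

/-! ### K9. T0 holds: the tower is ROOTED in the engine class

`abTower_rooted`: under the crux hypotheses, a scar-violator sequence zooms to a TWIN-SCAR OBJECT in
the engine class `ABTower` — singular at the space-time origin and at a unit vector `e`, which is a
SATELLITE.  This is the tree proof of `SliceBudget.exists_twinScarObject_inBall`
(Theorems/TypeIQuarterGateScarEnvelopeTypeIABTwinScar.lean) re-run VERBATIM, keeping the two outputs
(the weak gradient `H` on the slab and `𝐈 < ⊤`) of the budget-zoom engine
`SliceBudget.exists_typeIAncientMild_twinZoomLimit_budget` that the tree statement discards (tree-side
this is a two-token patch of the `obtain` pattern; HOME-side we re-run the proof).  Consequently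
(`exists_abTower_of_not_scarEnvelopeTypeI`): if the crux item 23843 FAILS, a rooted satellite tower
exists — an `ABTower` twin-scar object with a satellite on the unit sphere — and by K6 ★ / K8 ★★ / K7 ★
the zoom dictionary, closure and persistence hold at every level below it. -/

open Literature.Analysis in
open Summit.NavierStokesRegularity.NavierStokesRegularity.Cruxes.ScarEnvelopeTypeI in
open Summit.NavierStokesRegularity.NavierStokesRegularity.Cruxes.ScarEnvelopeTypeI.ScarZoom
  (CruxHypotheses ScarViolators TwinScarObject singularAt_of_isBackwardSingularPoint
    exists_localEnergy_of_typeIBound) in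
/-- **(T0) Rooting in the engine class.**  Under the crux hypotheses, scar violators zoom to an
`ABTower` twin-scar object: Type-I ancient mild with rate `M`, in A–B's class on every ball, weak
gradient on the backward slab, `𝐈 < ⊤`, singular at `0` and at `(0, e)`, `‖e‖ = 1`. -/
theorem abTower_rooted :
    ∀ (ν T : ℝ) (u : ℝ → (EuclideanSpace ℝ (Fin 3)) → (EuclideanSpace ℝ (Fin 3))) (p : ℝ → (EuclideanSpace ℝ (Fin 3)) → ℝ),
      CruxHypotheses ν T u p → ScarViolators T u →
        ∃ (M : ℝ) (v : ℝ → (EuclideanSpace ℝ (Fin 3)) → (EuclideanSpace ℝ (Fin 3))) (P : ℝ → (EuclideanSpace ℝ (Fin 3)) → ℝ) (H : ℝ → (EuclideanSpace ℝ (Fin 3)) → (EuclideanSpace ℝ (Fin 3)) →L[ℝ] (EuclideanSpace ℝ (Fin 3))) (e : (EuclideanSpace ℝ (Fin 3))),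
          ABTower M v P H ∧ TwinScarObject M v ∧ ‖e‖ = 1 ∧
            IsBackwardSingularPoint v 0 ∧ IsBackwardSingularPoint v ((0 : ℝ), e) := by
  intro ν T u p hH hV
  obtain ⟨hν, hT, hmax, hLH, -, hTI, -⟩ := hH
  obtain ⟨a, x, t, ht, hxa, ht_tend, hx_tend, hratio, hprod⟩ := hV
  have hsol := hmax.1
  -- ## (1) Morrey bound and the viscosity-normalising zoom about the scar `(T, a)`
  obtain ⟨r₀, M₀, T₁, hr₀, hT₁, hMor⟩ :=
    Summit.NavierStokesRegularity.NavierStokesRegularity.Theorems.morrey_of_typeI hν hT hsol hLH hTI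
  obtain ⟨R, α, β, hR, hα, hβ, -, -, hβT, hball, hGv, htypeI⟩ :=
    Summit.NavierStokesRegularity.NavierStokesRegularity.Theorems.exists_zoom_typeIBound_lt_top_of_morrey
      hν hT hsol hLH hr₀ hT₁ hMor a
  set q : ℝ → (EuclideanSpace ℝ (Fin 3)) → ℝ := fun t x => p t x - (p t 0 - normalisedPressure (u t) 0) with hq
  set v : ℝ → (EuclideanSpace ℝ (Fin 3)) → (EuclideanSpace ℝ (Fin 3)) := α • stPull β R T a u with hv
  set πv : ℝ → (EuclideanSpace ℝ (Fin 3)) → ℝ := α ^ 2 • stPull β R T a q with hπv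
  set Gv : ℝ → (EuclideanSpace ℝ (Fin 3)) → (EuclideanSpace ℝ (Fin 3)) →L[ℝ] (EuclideanSpace ℝ (Fin 3)) := (α * R) • stPull β R T a (fun t x => fderiv ℝ (u t) x)
    with hGvdef
  -- ## (2) the scar is a genuine singular point
  have hnorm : Tendsto (fun k => ‖u (t k) (x k)‖) atTop atTop := by
    have hdist : Tendsto (fun k => ‖x k - a‖) atTop (𝓝 0) :=
      tendsto_iff_norm_sub_tendsto_zero.1 hx_tend
    have hsmall : ∀ᶠ k in atTop, ‖x k - a‖ ≤ 1 :=
      hdist.eventually (Iic_mem_nhds one_pos)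
    refine tendsto_atTop_mono' atTop ?_ hprod
    filter_upwards [hsmall] with k hk
    calc ‖x k - a‖ * ‖u (t k) (x k)‖ ≤ 1 * ‖u (t k) (x k)‖ :=
        mul_le_mul_of_nonneg_right hk (norm_nonneg _)
      _ = ‖u (t k) (x k)‖ := one_mul _
  have hnotbd : ¬ IsBackwardBoundedAt u T a := by
    rintro ⟨r, hr, K, hK⟩
    have h1 : ∀ᶠ k in atTop, T - r ^ 2 < t k := ht_tend.eventually (lt_mem_nhds (by nlinarith))
    have h2 : ∀ᶠ k in atTop, x k ∈ ball a r := hx_tend.eventually_mem (ball_mem_nhds a hr)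
    have h3 : ∀ᶠ k in atTop, K < ‖u (t k) (x k)‖ := hnorm.eventually (eventually_gt_atTop K)
    obtain ⟨k, hk1, hk2, hk3⟩ := (h1.and (h2.and h3)).exists
    exact absurd (hK (t k) ⟨hk1, (ht k).2⟩ (x k) hk2) (not_le.2 hk3)
  have hsing : IsBackwardSingularPoint v (0 : ℝ × (EuclideanSpace ℝ (Fin 3))) := by
    intro r hr
    by_contra hfin
    have hfin' : eLpNorm (Function.uncurry v) ⊤
        (volume.restrict (parabolicCylinder (min r 1) (0 : ℝ × (EuclideanSpace ℝ (Fin 3))))) < ⊤ := by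
      refine lt_of_le_of_lt (eLpNorm_mono_measure _ (Measure.restrict_mono ?_ le_rfl))
        (lt_top_iff_ne_top.2 hfin)
      exact parabolicCylinder_mono (le_min hr.le zero_le_one) (min_le_left _ _) _
    exact hnotbd (SereginSverak2002.isBackwardBoundedAt_of_zoom hsol a hR hα hβ hβT
      (lt_min hr one_pos) (min_le_right _ _) hfin')
  -- ## (3) the trivial budget (`q = ⊤`): the budget-carrying twin zoom is used only for its
  -- Albritton–Barker-class output
  have hbudv : ∀ t' ∈ Ioo ((0 : ℝ × (EuclideanSpace ℝ (Fin 3))).1 - 1) (0 : ℝ × (EuclideanSpace ℝ (Fin 3))).1, ∀ ℓ' : ℝ,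
      Real.sqrt ((0 : ℝ × (EuclideanSpace ℝ (Fin 3))).1 - t') ≤ ℓ' → ℓ' ≤ 1 →
      ∫⁻ y in {y : (EuclideanSpace ℝ (Fin 3)) | ℓ' < ‖y - (0 : ℝ × (EuclideanSpace ℝ (Fin 3))).2‖ ∧ ‖y - (0 : ℝ × (EuclideanSpace ℝ (Fin 3))).2‖ < Real.exp 1 * ℓ'},
        ‖v t' y‖ₑ ^ (3 : ℝ) ≤ (⊤ : ℝ≥0∞) := fun _ _ _ _ _ => le_top
  -- ## (4) the rate of the zoom on a final window and the data on `Q(0, ρ')`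
  obtain ⟨C, δ, hC0, hδ, -, hrate⟩ :=
    Summit.NavierStokesRegularity.NavierStokesRegularity.Theorems.exists_typeI_rate_window hT hTI
  set C₁ : ℝ := α * C / Real.sqrt β with hC₁def
  have hratev : ∀ s ∈ Ioo (-(δ / β)) 0, ∀ y, ‖v s y‖ ≤ C₁ / Real.sqrt (-s) := by
    intro s hs y
    have h1 : -δ < β * s := by
      have h := mul_lt_mul_of_pos_left hs.1 hβ
      rwa [mul_neg, mul_div_cancel₀ _ hβ.ne'] at h
    have h2 : β * s < 0 := mul_neg_of_pos_of_neg hβ hs.2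
    have hb := hrate (T + β * s) ⟨by linarith, by linarith⟩ (a + R • y)
    have hsq : Real.sqrt (T - (T + β * s)) = Real.sqrt β * Real.sqrt (-s) := by
      rw [show T - (T + β * s) = β * (-s) by ring, Real.sqrt_mul hβ.le]
    rw [hsq] at hb
    have hpos : 0 < Real.sqrt (-s) := Real.sqrt_pos.2 (by linarith [hs.2])
    have hposβ : 0 < Real.sqrt β := Real.sqrt_pos.2 hβ
    rw [hv, smul_stPull_apply, norm_smul, Real.norm_of_nonneg hα.le, hC₁def]
    rw [div_div, le_div_iff₀ (by positivity)]
    calc α * ‖u (T + β * s) (a + R • y)‖ * (Real.sqrt β * Real.sqrt (-s))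
        = α * (Real.sqrt β * Real.sqrt (-s) * ‖u (T + β * s) (a + R • y)‖) := by ring
      _ ≤ α * C := mul_le_mul_of_nonneg_left hb hα.le
  set ρ' : ℝ := min (1 / 2) (Real.sqrt (δ / β)) with hρ'def
  have hρ' : 0 < ρ' := lt_min (by norm_num) (Real.sqrt_pos.2 (div_pos hδ hβ))
  have hρ'half : ρ' ≤ 1 / 2 := min_le_left _ _
  have hρ'1 : ρ' ≤ 1 := hρ'half.trans (by norm_num)
  have hρ'sq : ρ' ^ 2 ≤ δ / β := by
    have h1 : ρ' ≤ Real.sqrt (δ / β) := min_le_right _ _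
    have := pow_le_pow_left₀ hρ'.le h1 2
    rwa [Real.sq_sqrt (div_pos hδ hβ).le] at this
  have hsub1 : parabolicCylinder ρ' (0 : ℝ × (EuclideanSpace ℝ (Fin 3))) ⊆ parabolicCylinder 1 (0 : ℝ × (EuclideanSpace ℝ (Fin 3))) :=
    parabolicCylinder_mono hρ'.le hρ'1 _
  have hsubh : parabolicCylinder ρ' (0 : ℝ × (EuclideanSpace ℝ (Fin 3))) ⊆ parabolicCylinder (1 / 2) (0 : ℝ × (EuclideanSpace ℝ (Fin 3))) :=
    parabolicCylinder_mono hρ'.le hρ'half _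
  have hball' : IsSuitableWeakSolutionInBall ρ' 0 v πv := hball.of_subset_zero hρ' hsub1
  have hGv' : HasWeakSpatialGradientOn (parabolicCylinderOpens ρ' (0 : ℝ × (EuclideanSpace ℝ (Fin 3)))) v Gv :=
    hGv.mono fun w hw => hsub1 hw
  have hI' : typeIBound (parabolicCylinder ρ' (0 : ℝ × (EuclideanSpace ℝ (Fin 3)))) v πv Gv < ⊤ :=
    lt_of_le_of_lt (typeIBound_mono hsubh) htypeI
  have hwin : ∀ w ∈ parabolicCylinder ρ' (0 : ℝ × (EuclideanSpace ℝ (Fin 3))), w.1 ∈ Ioo (-(δ / β)) 0 ∧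
      T + β * w.1 ∈ Ico 0 T := by
    intro w hw
    rw [mem_parabolicCylinder] at hw
    simp only [Prod.fst_zero, zero_sub] at hw
    obtain ⟨⟨h1, h2⟩, -⟩ := hw
    have h3 : -(δ / β) < w.1 := by linarith
    have hρ'sq1 : ρ' ^ 2 ≤ 1 := by nlinarith
    have h4 : β * ρ' ^ 2 ≤ β * 1 := mul_le_mul_of_nonneg_left hρ'sq1 hβ.le
    have h5 : β * (-ρ' ^ 2) < β * w.1 := mul_lt_mul_of_pos_left h1 hβ
    have h6 : β * w.1 < β * 0 := mul_lt_mul_of_pos_left h2 hβ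
    refine ⟨⟨h3, h2⟩, ?_, by linarith⟩
    linarith
  have hvc' : ContinuousOn (Function.uncurry v) (parabolicCylinder ρ' (0 : ℝ × (EuclideanSpace ℝ (Fin 3)))) := by
    have hcontu : ContinuousOn (Function.uncurry u) (Ico 0 T ×ˢ univ) := hsol.smooth_velocity.continuousOn
    have e : Function.uncurry v = fun w => α • (Function.uncurry u ∘ stAffine β R T a) w := by
      funext w
      rfl
    rw [e]
    refine ContinuousOn.const_smul (hcontu.comp (continuous_stAffine _ _ _ _).continuousOn ?_) α
    intro w hw
    rw [mem_prod, stAffine_fst]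
    exact ⟨(hwin w hw).2, mem_univ _⟩
  have hrate' : ∀ (s : ℝ) (y : (EuclideanSpace ℝ (Fin 3))), (s, y) ∈ parabolicCylinder ρ' (0 : ℝ × (EuclideanSpace ℝ (Fin 3))) →
      ‖v s y‖ ≤ C₁ / Real.sqrt ((0 : ℝ × (EuclideanSpace ℝ (Fin 3))).1 - s) := by
    intro s y hsy
    show ‖v s y‖ ≤ C₁ / Real.sqrt ((0 : ℝ) - s)
    rw [zero_sub]
    exact hratev s (hwin _ hsy).1 y
  -- ## (5) scales, satellites and the values at the satellites
  have hρpos : ∀ k, 0 < ‖x k - a‖ := fun k => norm_pos_iff.2 (sub_ne_zero.2 (hxa k))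
  set Rz : ℕ → ℝ := fun k => ‖x k - a‖ / R with hRz
  have hRz_pos : ∀ k, 0 < Rz k := fun k => div_pos (hρpos k) hR
  have hRz0 : Tendsto Rz atTop (𝓝 0) := by
    have h := (tendsto_iff_norm_sub_tendsto_zero.1 hx_tend).div_const R
    rwa [zero_div] at h
  set sN : ℕ → ℝ := fun k => (t k - T) / (β * Rz k ^ 2) with hsN
  have hsN_neg : ∀ k, sN k < 0 := fun k =>
    div_neg_of_neg_of_pos (by linarith [(ht k).2]) (mul_pos hβ (pow_pos (hRz_pos k) 2))
  have hsN0 : Tendsto sN atTop (𝓝 0) := by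
    have e : ∀ k, sN k = -(R ^ 2 / β) * ((T - t k) / ‖x k - a‖ ^ 2) := by
      intro k
      have h1 : ‖x k - a‖ ≠ 0 := (hρpos k).ne'
      simp only [hsN, hRz]
      field_simp
      ring
    rw [show sN = fun k => -(R ^ 2 / β) * ((T - t k) / ‖x k - a‖ ^ 2) from funext e]
    simpa using hratio.const_mul (-(R ^ 2 / β))
  set ηN : ℕ → (EuclideanSpace ℝ (Fin 3)) := fun k => ‖x k - a‖⁻¹ • (x k - a) with hηN
  have hηN_mem : ∀ k, ηN k ∈ sphere (0 : (EuclideanSpace ℝ (Fin 3))) 1 := by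
    intro k
    rw [mem_sphere_zero_iff_norm, hηN]
    dsimp only
    rw [norm_smul, norm_inv, norm_norm, inv_mul_cancel₀ (hρpos k).ne']
  obtain ⟨e, he, ψ, hψ, hηe⟩ := (isCompact_sphere (0 : (EuclideanSpace ℝ (Fin 3))) 1).tendsto_subseq hηN_mem
  have he1 : ‖e‖ = 1 := mem_sphere_zero_iff_norm.1 he
  have harg1 : ∀ k, T + β * (Rz k ^ 2 * sN k) = t k := by
    intro k
    have h1 : Rz k ≠ 0 := (hRz_pos k).ne'
    simp only [hsN]
    field_simp
    ring
  have harg2 : ∀ k, a + R • (Rz k • ηN k) = x k := by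
    intro k
    have h1 : ‖x k - a‖ ≠ 0 := (hρpos k).ne'
    simp only [hRz, hηN, smul_smul]
    rw [show R * (‖x k - a‖ / R * ‖x k - a‖⁻¹) = 1 by field_simp, one_smul, add_sub_cancel]
  have hval : ∀ k, Rz k * ‖v ((0 : ℝ × (EuclideanSpace ℝ (Fin 3))).1 + Rz k ^ 2 * sN k) ((0 : ℝ × (EuclideanSpace ℝ (Fin 3))).2 + Rz k • ηN k)‖ =
      (α / R) * (‖x k - a‖ * ‖u (t k) (x k)‖) := by
    intro k
    rw [Prod.fst_zero, Prod.snd_zero, zero_add, zero_add, hv, smul_stPull_apply, harg1, harg2,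
      norm_smul, Real.norm_of_nonneg hα.le, hRz]
    ring
  have hsat : Tendsto (fun n => Rz (ψ n) *
      ‖v ((0 : ℝ × (EuclideanSpace ℝ (Fin 3))).1 + Rz (ψ n) ^ 2 * sN (ψ n)) ((0 : ℝ × (EuclideanSpace ℝ (Fin 3))).2 + Rz (ψ n) • ηN (ψ n))‖)
      atTop atTop := by
    simp only [hval]
    exact (hprod.comp hψ.tendsto_atTop).const_mul_atTop (div_pos hα hR)
  -- ## (6) the twin zoom limit carrying the budget
  obtain ⟨U, P, H, hTI', hInBall, -, hHU, hIU, hsing0, hsinge, -⟩ :=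
    SliceBudget.exists_typeIAncientMild_twinZoomLimit_budget (z₀ := (0 : ℝ × (EuclideanSpace ℝ (Fin 3)))) (M := C₁) hρ' hball' hGv'
      hI' hvc' hrate' hsing one_pos one_pos hbudv
      (R := fun n => Rz (ψ n)) (fun n => hRz_pos (ψ n)) (hRz0.comp hψ.tendsto_atTop)
      (s := fun n => sN (ψ n)) (η := fun n => ηN (ψ n)) (e := e) he1 (fun n => hsN_neg (ψ n))
      (hsN0.comp hψ.tendsto_atTop) hηe hsat
  -- ## (7) the twin-scar object IN THE ENGINE CLASS (keeping `H` and `𝐈 < ⊤`)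
  obtain ⟨E, hE⟩ := exists_localEnergy_of_typeIBound hTI'.continuousOn_uncurry hIU
  refine ⟨C₁, U, P, H, e, ⟨hTI', hInBall, hHU, hIU⟩,
    ⟨hTI', ⟨E, hE⟩, ?_, e, he1, singularAt_of_isBackwardSingularPoint hsinge⟩, he1, hsing0, hsinge⟩
  exact singularAt_of_isBackwardSingularPoint
    (show IsBackwardSingularPoint U (((0 : ℝ), (0 : (EuclideanSpace ℝ (Fin 3)))) : ℝ × (EuclideanSpace ℝ (Fin 3))) from hsing0)

/-- A backward singular point at the final time is not a regular point (`RegPt`). -/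
theorem not_regPt_of_isBackwardSingularPoint {U : ℝ → (EuclideanSpace ℝ (Fin 3)) → (EuclideanSpace ℝ (Fin 3))} {y : (EuclideanSpace ℝ (Fin 3))}
    (h : IsBackwardSingularPoint U ((0 : ℝ), y)) : ¬ RegPt U y := by
  rintro ⟨r, hr, M, hM⟩
  have h1 : eLpNorm (Function.uncurry U) ⊤ (volume.restrict (parabolicCylinder r ((0 : ℝ), y))) ≤
      ENNReal.ofReal M := by
    rw [eLpNorm_exponent_top]
    exact eLpNormEssSup_le_of_ae_bound (hM.mono fun z hz => hz)
  rw [h r hr] at h1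
  exact not_le.2 ENNReal.ofReal_lt_top h1

/-- Final-time singular points off the origin are satellites. -/
theorem mem_satellites_of_isBackwardSingularPoint {U : ℝ → (EuclideanSpace ℝ (Fin 3)) → (EuclideanSpace ℝ (Fin 3))} {e : (EuclideanSpace ℝ (Fin 3))} (he : e ≠ 0)
    (h : IsBackwardSingularPoint U ((0 : ℝ), e)) : e ∈ satellites U :=
  ⟨he, not_regPt_of_isBackwardSingularPoint h⟩

open Summit.NavierStokesRegularity.NavierStokesRegularity.Cruxes.ScarEnvelopeTypeI in
/-- **Scar violators ⇒ a rooted tower**: an `ABTower` twin-scar object, singular at the origin, with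
a satellite `e` on the unit sphere. -/
theorem exists_abTower_of_scarViolators {ν T : ℝ} {u : ℝ → (EuclideanSpace ℝ (Fin 3)) → (EuclideanSpace ℝ (Fin 3))} {p : ℝ → (EuclideanSpace ℝ (Fin 3)) → ℝ}
    (hH : ScarZoom.CruxHypotheses ν T u p) (hV : ScarZoom.ScarViolators T u) :
    ∃ (M : ℝ) (U : ℝ → (EuclideanSpace ℝ (Fin 3)) → (EuclideanSpace ℝ (Fin 3))) (P : ℝ → (EuclideanSpace ℝ (Fin 3)) → ℝ) (H : ℝ → (EuclideanSpace ℝ (Fin 3)) → (EuclideanSpace ℝ (Fin 3)) →L[ℝ] (EuclideanSpace ℝ (Fin 3))) (e : (EuclideanSpace ℝ (Fin 3))),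
      ABTower M U P H ∧ ScarZoom.TwinScarObject M U ∧ ¬ RegPt U 0 ∧ e ∈ satellites U ∧ ‖e‖ = 1 := by
  obtain ⟨M, U, P, H, e, hAB, hTS, he1, hs0, hse⟩ := abTower_rooted ν T u p hH hV
  have he0 : e ≠ 0 := by
    intro h0
    rw [h0, norm_zero] at he1
    exact zero_ne_one he1
  exact ⟨M, U, P, H, e, hAB, hTS,
    not_regPt_of_isBackwardSingularPoint (show IsBackwardSingularPoint U ((0 : ℝ), (0 : (EuclideanSpace ℝ (Fin 3)))) from hs0),
    mem_satellites_of_isBackwardSingularPoint he0 hse, he1⟩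

open Summit.NavierStokesRegularity.NavierStokesRegularity.Cruxes.ScarEnvelopeTypeI in
/-- **Not satellite-free ⇒ a rooted tower.** -/
theorem exists_abTower_of_not_noSatellite {ν T : ℝ} {u : ℝ → (EuclideanSpace ℝ (Fin 3)) → (EuclideanSpace ℝ (Fin 3))} {p : ℝ → (EuclideanSpace ℝ (Fin 3)) → ℝ}
    (h : ScarZoom.CruxHypotheses ν T u p) (hns : ¬ NoSatellite ν T u) :
    ∃ (M : ℝ) (U : ℝ → (EuclideanSpace ℝ (Fin 3)) → (EuclideanSpace ℝ (Fin 3))) (P : ℝ → (EuclideanSpace ℝ (Fin 3)) → ℝ) (H : ℝ → (EuclideanSpace ℝ (Fin 3)) → (EuclideanSpace ℝ (Fin 3)) →L[ℝ] (EuclideanSpace ℝ (Fin 3))) (e : (EuclideanSpace ℝ (Fin 3))),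
      ABTower M U P H ∧ ScarZoom.TwinScarObject M U ∧ ¬ RegPt U 0 ∧ e ∈ satellites U ∧ ‖e‖ = 1 :=
  exists_abTower_of_scarViolators h (not_not.1 fun hV => hns ((noSatellite_iff_not_scarViolators h).2 hV))

open Summit.NavierStokesRegularity.NavierStokesRegularity.Cruxes.ScarEnvelopeTypeI in
/-- **If the crux item 23843 fails, a rooted satellite tower exists**: some crux-class Type-I blow-up
has scar violators, which zoom to an `ABTower` twin-scar object with a satellite on the unit sphere;
the dictionary (K6 ★), closure (K8 ★★) and persistence (K7 ★) then apply at every level below it. -/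
theorem exists_abTower_of_not_scarEnvelopeTypeI
    (h : ¬ Summit.NavierStokesRegularity.NavierStokesRegularity.Theses.TypeIQuarterGate.ScarEnvelopeTypeI) :
    ∃ (M : ℝ) (U : ℝ → (EuclideanSpace ℝ (Fin 3)) → (EuclideanSpace ℝ (Fin 3))) (P : ℝ → (EuclideanSpace ℝ (Fin 3)) → ℝ) (H : ℝ → (EuclideanSpace ℝ (Fin 3)) → (EuclideanSpace ℝ (Fin 3)) →L[ℝ] (EuclideanSpace ℝ (Fin 3))) (e : (EuclideanSpace ℝ (Fin 3))),
      ABTower M U P H ∧ ScarZoom.TwinScarObject M U ∧ ¬ RegPt U 0 ∧ e ∈ satellites U ∧ ‖e‖ = 1 := by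
  rw [scarEnvelopeTypeI_iff_noScarViolators] at h
  push Not at h
  obtain ⟨ν, T, u, p, hH, hV⟩ := h
  exact exists_abTower_of_scarViolators hH hV

end Tower

end Summit.NavierStokesRegularity.NavierStokesRegularity.Cruxes.ScarEnvelopeTypeI.ZoomDictionary
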